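import Summits.Parity.GeneralizedHardyLittlewood.Theorems.PrimeLevelFamEdgeMomentsBeyondDiagonalDiagRemP2TailBoundPow
import HarnessLib

/-!
# Route `PrimeLevelFamEdge`, crux K_A `MomentsBeyondDiagonal` (stmt-Parity-20007), line «petersson_layers» v4, stub `stub_diag`:
# **the abstract convolution-tail lemma with a power-of-log rate** (brick D5 of «D4TAIL»; the pattern of (P2TAIL)_A made generic)

The last link of every «decorated tail» estimate of this chain ((P2TAIL)_A = `…DiagRemP2TailBoundPow.abs_sum_copTauW_primeSq_sub_le_pow`,
and the pending «D4TAIL»_A of `…DiagRemBothSidedDecorFour`) is the same bookkeeping: a Dirichlet convolution `β ∗ η` whose first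
factor has CONVERGENT partial sums with a power-of-log rate, `Σ_{j ≤ z} β(j) = κ + O(K_β(1+log z)⁻ᴬ)`, and whose second factor is
absolutely summable with room, `Σ_m |η(m)| m^{1/16} ≤ M`, has partial sums `Σ_{k ≤ y}(β∗η)(k) = Σ_{m ≤ y} η(m)·Σ_{j ≤ y/m} β(j) =
κ·Σ_m η(m) + O((K_β + |κ|)·M·(1+log y)⁻ᴬ)`. This file proves it ONCE, abstractly, so that «D4TAIL» (route of `…DiagRemMoebiusLogPow`:
`β` = the Möbius kernels `Σ_{de=j} μ(d)μ(e)(log d − log e)^r/(de)` of `…DiagRemHyperbolaProduct`, `η` = the `t`-deformed local factors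
`h_n^{(c)}`) is reduced to the identity and the local-factor bounds.

* `summable_abs_of_summable_abs_mul_rpow` — `Σ|η(m)|m^{1/16} < ∞ ⟹ Σ|η(m)| < ∞` (`η(0) = 0`);
* `exists_convTail_const` — **for every `A` there is `C_A ≥ 0` such that for all `β η κ K_β M` as above and all `y ≥ 1`,
  `|Σ_{m ≤ y} η(m)Σ_{j ≤ ⌊y⌋/m} β(j) − κΣ_m η(m)| ≤ C_A(K_β + |κ|)M/(1 + log y)ᴬ`.**

Def-free; theorems only; elementary given the tree's `inv_log_pow_le_rpow_sixteenth_mul_pow` and `rpow_neg_le_div_log_pow`.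
Helper `--supports stmt-Parity-20007`; closes nothing; K_A, K_B and the Parity summit are NOT proved; nothing about Landau–Siegel zeros.

## References
* E. Kowalski, P. Michel, J. VanderKam, J. reine angew. Math. 526 (2000), Prop. 5.1 p. 18.
  [cite: KowalskiMichelVanderKam2000, Prop. 5.1 — derivation (tails of the decorated Selberg coefficients)]
-/

noncomputable section

open Finset Real

namespace Summit.Parity.GeneralizedHardyLittlewood.Theorems.MomentsBeyondDiagonal.DiagCorner

open Summit.Parity.GeneralizedHardyLittlewood.Theorems.BeyondDiagonalBeatsQuarter.Corner (rpow_neg_le_div_log_pow)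

/-- `Σ_m |η(m)| m^{1/16} < ∞` and `η(0) = 0` give `Σ_m |η(m)| < ∞`. [folklore] -/
theorem summable_abs_of_summable_abs_mul_rpow {η : ℕ → ℝ} (hη0 : η 0 = 0)
    (hηs : Summable fun m : ℕ ↦ |η m| * (m : ℝ) ^ (1 / 16 : ℝ)) : Summable fun m : ℕ ↦ |η m| := by
  refine Summable.of_nonneg_of_le (fun m ↦ abs_nonneg _) (fun m ↦ ?_) hηs
  rcases Nat.eq_zero_or_pos m with rfl | hm
  · simp [hη0]
  · have hm1 : (1 : ℝ) ≤ m := by exact_mod_cast hm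
    have h1 : (1 : ℝ) ≤ (m : ℝ) ^ (1 / 16 : ℝ) := Real.one_le_rpow hm1 (by norm_num)
    nlinarith [abs_nonneg (η m)]

set_option maxHeartbeats 1600000 in
/-- **The abstract convolution tail with a power-of-log rate.** For every `A` there is `C_A ≥ 0` such that: whenever
`|Σ_{j ≤ z} β(j) − κ| ≤ K_β/(1+log z)ᴬ` for all `z ≥ 1` (`K_β ≥ 0`), `η(0) = 0`, `Σ_m |η(m)|m^{1/16}` is summable with sum `≤ M`, then
for all `y ≥ 1`, `|Σ_{m ≤ y} η(m)·Σ_{j ≤ ⌊y⌋/m} β(j) − κ·Σ_m η(m)| ≤ C_A(K_β + |κ|)M/(1 + log y)ᴬ`.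
[cite: KowalskiMichelVanderKam2000, Prop. 5.1 — derivation (tails of the decorated Selberg coefficients)] -/
theorem exists_convTail_const (A : ℕ) :
    ∃ C : ℝ, 0 ≤ C ∧ ∀ (β η : ℕ → ℝ) (κ Kβ M : ℝ), 0 ≤ Kβ →
      (∀ z : ℝ, 1 ≤ z → |(∑ j ∈ Icc 1 ⌊z⌋₊, β j) - κ| ≤ Kβ / (1 + Real.log z) ^ A) →
      η 0 = 0 → (Summable fun m : ℕ ↦ |η m| * (m : ℝ) ^ (1 / 16 : ℝ)) →
      (∑' m : ℕ, |η m| * (m : ℝ) ^ (1 / 16 : ℝ)) ≤ M →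
      ∀ y : ℝ, 1 ≤ y →
        |(∑ m ∈ Icc 1 ⌊y⌋₊, η m * ∑ j ∈ Icc 1 (⌊y⌋₊ / m), β j) - κ * ∑' m : ℕ, η m| ≤
          C * (Kβ + |κ|) * M / (1 + Real.log y) ^ A := by
  obtain ⟨C₃₂, hC₃₂, h32⟩ := rpow_neg_le_div_log_pow (show (0 : ℝ) < 1 / 32 by norm_num) A
  obtain ⟨C₁₆, hC₁₆, h16⟩ := rpow_neg_le_div_log_pow (show (0 : ℝ) < 1 / 16 by norm_num) A
  refine ⟨(2 : ℝ) ^ A + C₃₂ + C₁₆, by positivity, fun β η κ Kβ M hKβ hβ hη0 hηs hηM y hy ↦ ?_⟩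
  have hy0 : 0 < y := by linarith
  set N : ℕ := ⌊y⌋₊ with hNdef
  set L : ℝ := Real.log y with hLdef
  have hL : 0 ≤ L := Real.log_nonneg hy
  have hN1 : 1 ≤ N := Nat.le_floor (by simpa using hy)
  have hM0 : 0 ≤ M := le_trans (tsum_nonneg fun m ↦ by positivity) hηM
  have hsa : Summable fun m : ℕ ↦ |η m| := summable_abs_of_summable_abs_mul_rpow hη0 hηs
  have hs : Summable η := hsa.of_abs
  -- `Σ_{m ≤ N} η = Σ' η − Σ'_{m > N} η`
  have htail_eq : ∑ m ∈ Icc 1 N, η m = ∑' m : ℕ, η m - ∑' m : ℕ, η (m + (N + 1)) := by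
    have h1 : ∑ m ∈ Icc 1 N, η m = ∑ m ∈ Finset.range (N + 1), η m := by
      have hI : Finset.range (N + 1) = insert 0 (Icc 1 N) := by
        ext m; simp only [Finset.mem_range, Finset.mem_insert, Finset.mem_Icc]; omega
      rw [hI, Finset.sum_insert (by simp), hη0, zero_add]
    rw [h1, ← hs.sum_add_tsum_nat_add (N + 1)]
    ring
  -- rearrangement
  set S : ℕ → ℝ := fun m ↦ ∑ j ∈ Icc 1 (N / m), β j with hSdef
  have hre : (∑ m ∈ Icc 1 N, η m * S m) - κ * ∑' m : ℕ, η m =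
      (∑ m ∈ Icc 1 N, η m * (S m - κ)) - κ * ∑' m : ℕ, η (m + (N + 1)) := by
    have h1 : ∑ m ∈ Icc 1 N, η m * (S m - κ) = (∑ m ∈ Icc 1 N, η m * S m) - κ * ∑ m ∈ Icc 1 N, η m := by
      rw [Finset.mul_sum, ← Finset.sum_sub_distrib]
      exact Finset.sum_congr rfl fun m _ ↦ by ring
    rw [h1, htail_eq]; ring
  rw [hre]
  -- facts about `m ∈ Icc 1 N`
  have hmem : ∀ m ∈ Icc 1 N, 1 ≤ m ∧ (0 : ℝ) < m ∧ (m : ℝ) ≤ y ∧ 1 ≤ y / m ∧ ⌊y / m⌋₊ = N / m := by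
    intro m hm
    have hm' := Finset.mem_Icc.1 hm
    have hm0 : (0 : ℝ) < m := by exact_mod_cast hm'.1
    have hmy : (m : ℝ) ≤ y := le_trans (by exact_mod_cast hm'.2) (Nat.floor_le hy0.le)
    exact ⟨hm'.1, hm0, hmy, by rw [le_div_iff₀ hm0]; linarith, by rw [hNdef]; exact Nat.floor_div_natCast y m⟩
  have hfin : ∑ m ∈ Icc 1 N, |η m| * (m : ℝ) ^ (1 / 16 : ℝ) ≤ M :=
    le_trans (hηs.sum_le_tsum _ (fun m _ ↦ by positivity)) hηM
  ------------------------------------------------------------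
  -- (a) the finite part
  ------------------------------------------------------------
  have ha : |∑ m ∈ Icc 1 N, η m * (S m - κ)| ≤ Kβ * ((2 : ℝ) ^ A + C₃₂) * M / (1 + L) ^ A := by
    have hterm : ∀ m ∈ Icc 1 N, |η m * (S m - κ)| ≤
        (|η m| * (m : ℝ) ^ (1 / 16 : ℝ)) * (Kβ * ((2 : ℝ) ^ A / (1 + L) ^ A + y ^ (-(1 / 32 : ℝ)))) := by
      intro m hm
      obtain ⟨hm1, hm0, hmy, hym, hfl⟩ := hmem m hm
      have h1 := hβ (y / m) hym
      rw [hfl] at h1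
      have h2 := inv_log_pow_le_rpow_sixteenth_mul_pow A hy hm1 hmy
      rw [abs_mul]
      calc |η m| * |S m - κ| ≤ |η m| * (Kβ / (1 + Real.log (y / m)) ^ A) :=
            mul_le_mul_of_nonneg_left h1 (abs_nonneg _)
        _ = |η m| * Kβ * (1 / (1 + Real.log (y / m)) ^ A) := by ring
        _ ≤ |η m| * Kβ * ((m : ℝ) ^ (1 / 16 : ℝ) * ((2 : ℝ) ^ A / (1 + L) ^ A + y ^ (-(1 / 32 : ℝ)))) :=
            mul_le_mul_of_nonneg_left h2 (by positivity)
        _ = _ := by ring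
    calc _ ≤ ∑ m ∈ Icc 1 N, (|η m| * (m : ℝ) ^ (1 / 16 : ℝ)) *
          (Kβ * ((2 : ℝ) ^ A / (1 + L) ^ A + y ^ (-(1 / 32 : ℝ)))) :=
          (Finset.abs_sum_le_sum_abs _ _).trans (Finset.sum_le_sum hterm)
      _ = (∑ m ∈ Icc 1 N, |η m| * (m : ℝ) ^ (1 / 16 : ℝ)) *
          (Kβ * ((2 : ℝ) ^ A / (1 + L) ^ A + y ^ (-(1 / 32 : ℝ)))) := by rw [Finset.sum_mul]
      _ ≤ M * (Kβ * ((2 : ℝ) ^ A / (1 + L) ^ A + C₃₂ / (1 + L) ^ A)) := by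
          refine mul_le_mul hfin ?_ (by positivity) hM0
          exact mul_le_mul_of_nonneg_left (by linarith [h32 y hy]) hKβ
      _ = Kβ * ((2 : ℝ) ^ A + C₃₂) * M / (1 + L) ^ A := by field_simp
  ------------------------------------------------------------
  -- (b) the tail `Σ_{m > N} η(m)`
  ------------------------------------------------------------
  have hb : |κ * ∑' m : ℕ, η (m + (N + 1))| ≤ |κ| * C₁₆ * M / (1 + L) ^ A := by
    have hsa' : Summable fun m : ℕ ↦ |η (m + (N + 1))| :=
      (summable_nat_add_iff (f := fun m : ℕ ↦ |η m|) (N + 1)).2 hsa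
    have hsw' : Summable fun m : ℕ ↦ |η (m + (N + 1))| * ((m + (N + 1) : ℕ) : ℝ) ^ (1 / 16 : ℝ) :=
      (summable_nat_add_iff (f := fun m : ℕ ↦ |η m| * (m : ℝ) ^ (1 / 16 : ℝ)) (N + 1)).2 hηs
    have hy16 : 0 < y ^ (1 / 16 : ℝ) := by positivity
    have htail : ∑' m : ℕ, |η (m + (N + 1))| * ((m + (N + 1) : ℕ) : ℝ) ^ (1 / 16 : ℝ) ≤ M := by
      have h := hηs.sum_add_tsum_nat_add (N + 1)
      have hnonneg : 0 ≤ ∑ i ∈ Finset.range (N + 1), |η i| * (i : ℝ) ^ (1 / 16 : ℝ) :=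
        Finset.sum_nonneg fun i _ ↦ by positivity
      linarith
    have hpt : ∀ m : ℕ, |η (m + (N + 1))| ≤
        (|η (m + (N + 1))| * ((m + (N + 1) : ℕ) : ℝ) ^ (1 / 16 : ℝ)) * y ^ (-(1 / 16 : ℝ)) := by
      intro m
      have hmy : y ≤ ((m + (N + 1) : ℕ) : ℝ) := by
        have : y < (N : ℝ) + 1 := Nat.lt_floor_add_one y
        push_cast; linarith
      have hpow : y ^ (1 / 16 : ℝ) ≤ ((m + (N + 1) : ℕ) : ℝ) ^ (1 / 16 : ℝ) :=
        Real.rpow_le_rpow hy0.le hmy (by norm_num)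
      have hh0 : 0 ≤ |η (m + (N + 1))| := abs_nonneg _
      rw [Real.rpow_neg hy0.le, ← div_eq_mul_inv, le_div_iff₀ hy16]
      exact mul_le_mul_of_nonneg_left hpow hh0
    rw [abs_mul]
    have hin : |∑' m : ℕ, η (m + (N + 1))| ≤ M * (C₁₆ / (1 + L) ^ A) := by
      calc |∑' m : ℕ, η (m + (N + 1))| ≤ ∑' m : ℕ, |η (m + (N + 1))| := by
            have := norm_tsum_le_tsum_norm (f := fun m : ℕ ↦ η (m + (N + 1))) (by simpa [Real.norm_eq_abs] using hsa')
            simpa [Real.norm_eq_abs] using this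
        _ ≤ ∑' m : ℕ, (|η (m + (N + 1))| * ((m + (N + 1) : ℕ) : ℝ) ^ (1 / 16 : ℝ)) * y ^ (-(1 / 16 : ℝ)) :=
            hsa'.tsum_le_tsum hpt (hsw'.mul_right _)
        _ = (∑' m : ℕ, |η (m + (N + 1))| * ((m + (N + 1) : ℕ) : ℝ) ^ (1 / 16 : ℝ)) * y ^ (-(1 / 16 : ℝ)) :=
            tsum_mul_right
        _ ≤ M * (C₁₆ / (1 + L) ^ A) := mul_le_mul htail (h16 y hy) (by positivity) hM0
    calc |κ| * |∑' m : ℕ, η (m + (N + 1))| ≤ |κ| * (M * (C₁₆ / (1 + L) ^ A)) :=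
          mul_le_mul_of_nonneg_left hin (abs_nonneg κ)
      _ = |κ| * C₁₆ * M / (1 + L) ^ A := by ring
  ------------------------------------------------------------
  -- assembly
  ------------------------------------------------------------
  have hML : 0 ≤ M / (1 + L) ^ A := by positivity
  calc |(∑ m ∈ Icc 1 N, η m * (S m - κ)) - κ * ∑' m : ℕ, η (m + (N + 1))|
      ≤ |∑ m ∈ Icc 1 N, η m * (S m - κ)| + |κ * ∑' m : ℕ, η (m + (N + 1))| := abs_sub _ _
    _ ≤ Kβ * ((2 : ℝ) ^ A + C₃₂) * M / (1 + L) ^ A + |κ| * C₁₆ * M / (1 + L) ^ A := add_le_add ha hb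
    _ = (Kβ * ((2 : ℝ) ^ A + C₃₂) + |κ| * C₁₆) * (M / (1 + L) ^ A) := by ring
    _ ≤ (((2 : ℝ) ^ A + C₃₂ + C₁₆) * (Kβ + |κ|)) * (M / (1 + L) ^ A) := by
        apply mul_le_mul_of_nonneg_right _ hML
        have h1 : Kβ * ((2 : ℝ) ^ A + C₃₂) ≤ Kβ * ((2 : ℝ) ^ A + C₃₂ + C₁₆) :=
          mul_le_mul_of_nonneg_left (by linarith) hKβ
        have h2 : |κ| * C₁₆ ≤ |κ| * ((2 : ℝ) ^ A + C₃₂ + C₁₆) :=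
          mul_le_mul_of_nonneg_left (by linarith [pow_nonneg (zero_le_two (α := ℝ)) A]) (abs_nonneg κ)
        nlinarith [abs_nonneg κ]
    _ = ((2 : ℝ) ^ A + C₃₂ + C₁₆) * (Kβ + |κ|) * M / (1 + L) ^ A := by ring

end Summit.Parity.GeneralizedHardyLittlewood.Theorems.MomentsBeyondDiagonal.DiagCorner

end
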